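import Mathlib.Analysis.Matrix.Order
import Mathlib.Analysis.Matrix.PosDef
import Mathlib.Analysis.SpecialFunctions.Log.Basic
import Literature.NumberTheory.Automorphic.AdelicGLnGlue
import HarnessLib

/-!
# The global Cartan (polar) decomposition of `GL_n(K_∞)`

Topic `NumberTheory/Automorphic`. The predicate `RealMatrixGroup.HasCartanDecomposition G`
(`RealMatrixGroups`: every `g ∈ G` is `k · exp X` with `k ∈ K = G ∩ U(N, A)` and `X ∈ 𝔤`
self-adjoint) is one of the regularity hypotheses `AutomorphyDatum.IsRegular` of Borel–Jacquet's
theory and a hypothesis of Harish-Chandra's theorems in `GKModules`; for the archimedean group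
`G_∞ = GL_n(K_∞) = GL_n(ℝ)^{r₁} × GL_n(ℂ)^{r₂}` (`archGroupGL n K` of `AdelicGLnGlue`) it is the
polar decomposition of invertible real and complex matrices. This file PROVES it:

* `exists_isHermitian_exp_mul_exp_eq` — for an invertible matrix `g` over `𝕜 = ℝ` or `ℂ` there
  is a Hermitian `L` with `exp L · exp L = gᴴ g` (`L = ½ log (gᴴ g)` through the spectral theorem:
  `gᴴ g = U diag(λ) U⋆` with `λ > 0`, `L = U diag(½ log λ) U⋆`);
* `exists_unitary_mul_exp_of_isUnit` — polar decomposition `g = k · exp L`, `k⋆ k = 1`,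
  `L` Hermitian, over `𝕜 = ℝ` or `ℂ`, and `RealMatrixGroup.hasCartanDecomposition_gl` — the
  Cartan decomposition of the full linear group `GL N 𝕜`;
* `hasCartanDecomposition_archGroupGL` — **`GL_n(K_∞) = K_∞ · exp 𝔭`** for
  `K_∞ = ∏ O(n) × ∏ U(n)`, assembled place by place (`exp` and `star` on matrices over
  `mixedSpace K = ℝ^{r₁} × ℂ^{r₂}` are computed componentwise: `map_exp` along the place
  evaluations, `mixedSpace_matrix_ext`).

Knapp, *Lie Groups Beyond an Introduction* (2002), I.§1, Prop. 1.2 (polar decomposition of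
`GL(n, ℝ)`, `GL(n, ℂ)`) and Thm. 6.31 (c); Borel–Jacquet 1979, §1.1.

## Design notes

* Everything is proved; no definition and no named fact is introduced. The matrix exponential
  is Mathlib's topology-only `NormedSpace.exp` (as in `RealMatrixGroups`, H3); the `L^∞`
  operator norm is opened locally only to invoke `map_exp`.
* The Hermitian logarithm is built from `Matrix.IsHermitian.eigenvectorUnitary` /
  `spectral_theorem` rather than `CFC.log`, to stay with the topology-only exponential.

## References

* A. W. Knapp, *Lie Groups Beyond an Introduction*, 2nd ed. (2002), I.§1, Prop. 1.2; VI.§2,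
  Thm. 6.31 [Knapp2002].
* A. Borel, H. Jacquet, *Automorphic forms and automorphic representations*, Corvallis 1979,
  §1.1 [BorelJacquet1979].
-/

open scoped MatrixGroups Matrix ComplexOrder Classical
open NumberField NumberField.mixedEmbedding
open NormedSpace -- for `exp`

noncomputable section

namespace Literature.NumberTheory.Automorphic

/-! ## The Hermitian logarithm of `gᴴ g` and the polar decomposition over `ℝ` or `ℂ` -/

section RCLike

variable {𝕜 : Type*} [RCLike 𝕜] {N : Type*} [Fintype N] [DecidableEq N]

/-- **Half the logarithm of `gᴴ g`.** For an invertible matrix `g` over `𝕜 = ℝ` or `ℂ` there is a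
Hermitian matrix `L` with `exp L · exp L = gᴴ g`: by the spectral theorem `gᴴ g = U diag(λ) U⋆`
with `U` unitary and `λᵢ > 0` (`gᴴ g` is positive definite), and `L = U diag(½ log λ) U⋆` works
since `exp` commutes with unitary conjugation and is computed entrywise on diagonal matrices.
Knapp 2002, I.§1, Prop. 1.2 (proof). [cite: Knapp2002, Prop. 1.2] -/
theorem exists_isHermitian_exp_mul_exp_eq {g : Matrix N N 𝕜} (hg : IsUnit g) :
    ∃ L : Matrix N N 𝕜, L.IsHermitian ∧ exp L * exp L = gᴴ * g := by
  have hP : (gᴴ * g).PosDef := by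
    refine (Matrix.posSemidef_conjTranspose_mul_self g).posDef_iff_isUnit.mpr ?_
    simpa only [Matrix.star_eq_conjTranspose] using hg.star.mul hg
  set U : unitary (Matrix N N 𝕜) := hP.1.eigenvectorUnitary with hU
  set d : N → ℝ := hP.1.eigenvalues with hd
  have hspec : gᴴ * g =
      (U : Matrix N N 𝕜) * Matrix.diagonal (RCLike.ofReal ∘ d) * (star U : Matrix N N 𝕜) := by
    have h := hP.1.spectral_theorem
    rwa [Unitary.conjStarAlgAut_apply] at h
  set v : N → 𝕜 := fun i ↦ ((Real.log (d i) / 2 : ℝ) : 𝕜) with hv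
  refine ⟨(U : Matrix N N 𝕜) * Matrix.diagonal v * (star U : Matrix N N 𝕜), ?_, ?_⟩
  · -- `L` is Hermitian: `diag(v)` has real entries
    have hDv : (Matrix.diagonal v)ᴴ = Matrix.diagonal v := by
      rw [Matrix.diagonal_conjTranspose]
      congr 1
      funext i
      simp [v]
    change ((U : Matrix N N 𝕜) * Matrix.diagonal v * (star U : Matrix N N 𝕜))ᴴ = _
    rw [Matrix.conjTranspose_mul, Matrix.conjTranspose_mul, hDv, ← Matrix.star_eq_conjTranspose,
      ← Matrix.star_eq_conjTranspose, star_star, mul_assoc]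
  · -- `exp L · exp L = U diag(exp v)² U⋆ = U diag(λ) U⋆ = gᴴ g`
    have h1 : ((Unitary.toUnits U : (Matrix N N 𝕜)ˣ) : Matrix N N 𝕜) = U := rfl
    have h2 : (((Unitary.toUnits U)⁻¹ : (Matrix N N 𝕜)ˣ) : Matrix N N 𝕜) =
        star (U : Matrix N N 𝕜) := by
      rw [← map_inv, ← Unitary.star_eq_inv]
      rfl
    have hconj : exp ((U : Matrix N N 𝕜) * Matrix.diagonal v * (star U : Matrix N N 𝕜)) =
        (U : Matrix N N 𝕜) * exp (Matrix.diagonal v) * (star U : Matrix N N 𝕜) := by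
      have h := Matrix.exp_units_conj (Unitary.toUnits U) (Matrix.diagonal v)
      rwa [h1, h2] at h
    have hexpv : exp (Matrix.diagonal v) =
        Matrix.diagonal fun i ↦ ((Real.exp (Real.log (d i) / 2) : ℝ) : 𝕜) := by
      rw [Matrix.exp_diagonal]
      congr 1
      funext i
      rw [Pi.exp_def]
      change exp (algebraMap ℝ 𝕜 (Real.log (d i) / 2)) = algebraMap ℝ 𝕜 (Real.exp (Real.log (d i) / 2))
      rw [Real.exp_eq_exp_ℝ]
      exact (map_exp (algebraMap ℝ 𝕜) (continuous_algebraMap ℝ 𝕜) _).symm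
    have hUU : (star U : Matrix N N 𝕜) * (U : Matrix N N 𝕜) = 1 := Unitary.coe_star_mul_self U
    have hsq : ∀ i, ((Real.exp (Real.log (d i) / 2) : ℝ) : 𝕜) * ((Real.exp (Real.log (d i) / 2) : ℝ) : 𝕜)
        = (RCLike.ofReal ∘ d) i := by
      intro i
      rw [Function.comp_apply, ← RCLike.ofReal_mul, ← Real.exp_add, add_halves,
        Real.exp_log (hP.eigenvalues_pos i)]
    rw [hconj, hexpv, hspec]
    calc (U : Matrix N N 𝕜) * Matrix.diagonal (fun i ↦ ((Real.exp (Real.log (d i) / 2) : ℝ) : 𝕜)) *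
          (star U : Matrix N N 𝕜) *
          ((U : Matrix N N 𝕜) * Matrix.diagonal (fun i ↦ ((Real.exp (Real.log (d i) / 2) : ℝ) : 𝕜)) *
            (star U : Matrix N N 𝕜))
        = (U : Matrix N N 𝕜) * (Matrix.diagonal (fun i ↦ ((Real.exp (Real.log (d i) / 2) : ℝ) : 𝕜)) *
            ((star U : Matrix N N 𝕜) * (U : Matrix N N 𝕜)) *
            Matrix.diagonal (fun i ↦ ((Real.exp (Real.log (d i) / 2) : ℝ) : 𝕜))) *
          (star U : Matrix N N 𝕜) := by
          simp only [mul_assoc]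
      _ = (U : Matrix N N 𝕜) * Matrix.diagonal (RCLike.ofReal ∘ d) * (star U : Matrix N N 𝕜) := by
          rw [hUU, mul_one, Matrix.diagonal_mul_diagonal]
          congr 2
          exact congrArg Matrix.diagonal (funext hsq)

/-- **Polar decomposition over `ℝ` or `ℂ`.** An invertible matrix `g` is `k · exp L` with
`k⋆ k = 1` (`k ∈ O(n)`, resp. `U(n)`) and `L` Hermitian: take `L` with `exp L · exp L = gᴴ g`
(`exists_isHermitian_exp_mul_exp_eq`) and `k = g · exp (-L)`. Knapp 2002, I.§1, Prop. 1.2. [cite: Knapp2002, Prop. 1.2] -/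
theorem exists_unitary_mul_exp_of_isUnit {g : Matrix N N 𝕜} (hg : IsUnit g) :
    ∃ k L : Matrix N N 𝕜, star k * k = 1 ∧ L.IsHermitian ∧ g = k * exp L := by
  obtain ⟨L, hL, hexp⟩ := exists_isHermitian_exp_mul_exp_eq hg
  refine ⟨g * exp (-L), L, ?_, hL, ?_⟩
  · have hLs : star L = L := hL
    have hneg : exp (-L) * exp L = (1 : Matrix N N 𝕜) := by
      rw [← Matrix.exp_add_of_commute (-L) L ((Commute.refl L).neg_left), neg_add_cancel, exp_zero]
    have hneg' : exp L * exp (-L) = (1 : Matrix N N 𝕜) := by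
      rw [← Matrix.exp_add_of_commute L (-L) ((Commute.refl L).neg_right), add_neg_cancel, exp_zero]
    calc star (g * exp (-L)) * (g * exp (-L))
        = exp (-L) * (gᴴ * g) * exp (-L) := by
          rw [star_mul, star_exp, star_neg, hLs, Matrix.star_eq_conjTranspose]
          simp only [mul_assoc]
      _ = exp (-L) * (exp L * exp L) * exp (-L) := by rw [hexp]
      _ = 1 := by
          calc exp (-L) * (exp L * exp L) * exp (-L)
              = (exp (-L) * exp L) * (exp L * exp (-L)) := by simp only [mul_assoc]
            _ = 1 := by rw [hneg, hneg', mul_one]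
  · rw [mul_assoc, ← Matrix.exp_add_of_commute (-L) L ((Commute.refl L).neg_left), neg_add_cancel,
      exp_zero, mul_one]

/-- **The Cartan decomposition of `GL N 𝕜`, `𝕜 = ℝ` or `ℂ`**: `GL(n, ℝ) = O(n) · exp(sym)`,
`GL(n, ℂ) = U(n) · exp(herm)` (`RealMatrixGroup.HasCartanDecomposition` for the full linear group
`RealMatrixGroup.gl`). Knapp 2002, I.§1, Prop. 1.2. [cite: Knapp2002, Prop. 1.2] -/
theorem RealMatrixGroup.hasCartanDecomposition_gl :
    (RealMatrixGroup.gl 𝕜 N).HasCartanDecomposition := by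
  intro g _
  obtain ⟨k, L, hk, hL, hgkL⟩ := exists_unitary_mul_exp_of_isUnit (Units.isUnit g)
  have hkU : IsUnit k := by
    have h : k = (g : Matrix N N 𝕜) * exp (-L) := by
      rw [hgkL, mul_assoc, ← Matrix.exp_add_of_commute L (-L) ((Commute.refl L).neg_right),
        add_neg_cancel, exp_zero, mul_one]
    rw [h]
    exact (Units.isUnit g).mul (Matrix.isUnit_exp _)
  refine ⟨hkU.unit, ?_, L, trivial, hL, ?_⟩
  · rw [RealMatrixGroup.mem_maximalCompact_iff]
    exact ⟨trivial, by simpa only [IsUnit.unit_spec] using hk⟩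
  · ext : 1
    rw [Units.val_mul, IsUnit.unit_spec, coe_expGL]
    exact hgkL

end RCLike

/-! ## `GL_n(K_∞) = K_∞ · exp 𝔭` -/

section MixedSpace

variable (n : ℕ) (K : Type) [Field K] [NumberField K]

omit [NumberField K] in
/-- `star` on matrices over `mixedSpace K` is computed at each real place. Borel–Jacquet 1979,
§1.1 (`G_∞ = ∏_w G_w`). [folklore] -/
theorem star_map_mixedSpaceEvalReal (w : {w : InfinitePlace K // w.IsReal})
    (M : Matrix (Fin n) (Fin n) (mixedSpace K)) :
    (star M).map (mixedSpaceEvalReal K w) = star (M.map (mixedSpaceEvalReal K w)) := by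
  rw [Matrix.star_eq_conjTranspose, Matrix.star_eq_conjTranspose, Matrix.conjTranspose_map]
  intro x
  rfl

omit [NumberField K] in
/-- `star` on matrices over `mixedSpace K` is computed at each complex place. Borel–Jacquet 1979,
§1.1. [folklore] -/
theorem star_map_mixedSpaceEvalComplex (w : {w : InfinitePlace K // w.IsComplex})
    (M : Matrix (Fin n) (Fin n) (mixedSpace K)) :
    (star M).map (mixedSpaceEvalComplex K w) = star (M.map (mixedSpaceEvalComplex K w)) := by
  rw [Matrix.star_eq_conjTranspose, Matrix.star_eq_conjTranspose, Matrix.conjTranspose_map]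
  intro x
  rfl

omit [NumberField K] in
/-- `M ↦ M_w`, the evaluation of a matrix over `mixedSpace K` at a real place, is continuous.
[folklore] -/
theorem continuous_map_mixedSpaceEvalReal (w : {w : InfinitePlace K // w.IsReal}) :
    Continuous fun M : Matrix (Fin n) (Fin n) (mixedSpace K) ↦ M.map (mixedSpaceEvalReal K w) :=
  continuous_id.matrix_map ((continuous_apply w).comp continuous_fst)

omit [NumberField K] in
/-- `M ↦ M_w`, the evaluation of a matrix over `mixedSpace K` at a complex place, is continuous.
[folklore] -/
theorem continuous_map_mixedSpaceEvalComplex (w : {w : InfinitePlace K // w.IsComplex}) :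
    Continuous fun M : Matrix (Fin n) (Fin n) (mixedSpace K) ↦ M.map (mixedSpaceEvalComplex K w) :=
  continuous_id.matrix_map ((continuous_apply w).comp continuous_snd)

-- As in `Mathlib/Analysis/Normed/Algebra/MatrixExponential.lean`: the scoped `L∞`-operator normed
-- ring structure on matrices is only reducibly-defeq to the Pi topology used by `map`.
set_option backward.isDefEq.respectTransparency false in
/-- The matrix exponential over `mixedSpace K` is computed at each real place (`map_exp` along the
continuous ring homomorphism `M ↦ M.map (eval_w)`). Borel–Jacquet 1979, §1.1. [folklore] -/
theorem exp_map_mixedSpaceEvalReal (w : {w : InfinitePlace K // w.IsReal})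
    (M : Matrix (Fin n) (Fin n) (mixedSpace K)) :
    (exp M).map (mixedSpaceEvalReal K w) = exp (M.map (mixedSpaceEvalReal K w)) :=
  open scoped Matrix.Norms.Operator in
  map_exp ((mixedSpaceEvalReal K w).mapMatrix :
      Matrix (Fin n) (Fin n) (mixedSpace K) →+* Matrix (Fin n) (Fin n) ℝ)
    (continuous_map_mixedSpaceEvalReal n K w) M

set_option backward.isDefEq.respectTransparency false in
/-- The matrix exponential over `mixedSpace K` is computed at each complex place. Borel–Jacquet
1979, §1.1. [folklore] -/
theorem exp_map_mixedSpaceEvalComplex (w : {w : InfinitePlace K // w.IsComplex})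
    (M : Matrix (Fin n) (Fin n) (mixedSpace K)) :
    (exp M).map (mixedSpaceEvalComplex K w) = exp (M.map (mixedSpaceEvalComplex K w)) :=
  open scoped Matrix.Norms.Operator in
  map_exp ((mixedSpaceEvalComplex K w).mapMatrix :
      Matrix (Fin n) (Fin n) (mixedSpace K) →+* Matrix (Fin n) (Fin n) ℂ)
    (continuous_map_mixedSpaceEvalComplex n K w) M

/-- **The global Cartan decomposition `GL_n(K_∞) = K_∞ · exp 𝔭`** of the archimedean group of
`GL_n` over a number field `K` (`archGroupGL n K = GL_n(ℝ^{r₁} × ℂ^{r₂})`,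
`K_∞ = ∏_{w real} O(n) × ∏_{w complex} U(n)`): every `g ∈ GL_n(K_∞)` is `k · exp X` with
`k ∈ K_∞` and `X` self-adjoint. Proof: the polar decomposition at each place
(`exists_isHermitian_exp_mul_exp_eq` over `ℝ` and over `ℂ`) gives a self-adjoint `X` with
`exp X · exp X = g⋆ g` componentwise, hence globally; then `k = g · exp (-X)` satisfies `k⋆ k = 1`.
Knapp 2002, I.§1, Prop. 1.2 and VI.§2, Thm. 6.31 (c); Borel–Jacquet 1979, §1.1. [cite: Knapp2002, Prop. 1.2 and Thm. 6.31] -/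
theorem hasCartanDecomposition_archGroupGL : (archGroupGL n K).HasCartanDecomposition := by
  intro g _
  -- the Hermitian half-logarithms of `g_wᴴ g_w` at every place
  have hR : ∀ w : {w : InfinitePlace K // w.IsReal},
      IsUnit ((g : Matrix (Fin n) (Fin n) (mixedSpace K)).map (mixedSpaceEvalReal K w)) :=
    fun w ↦ (Matrix.GeneralLinearGroup.map (mixedSpaceEvalReal K w) g).isUnit
  have hC : ∀ w : {w : InfinitePlace K // w.IsComplex},
      IsUnit ((g : Matrix (Fin n) (Fin n) (mixedSpace K)).map (mixedSpaceEvalComplex K w)) :=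
    fun w ↦ (Matrix.GeneralLinearGroup.map (mixedSpaceEvalComplex K w) g).isUnit
  choose Lr hLr hLr' using fun w ↦ exists_isHermitian_exp_mul_exp_eq (hR w)
  choose Lc hLc hLc' using fun w ↦ exists_isHermitian_exp_mul_exp_eq (hC w)
  -- glue them into a matrix over `mixedSpace K`
  let X : Matrix (Fin n) (Fin n) (mixedSpace K) := fun i j ↦ (fun w ↦ Lr w i j, fun w ↦ Lc w i j)
  have hXr : ∀ w, X.map (mixedSpaceEvalReal K w) = Lr w := fun w ↦ rfl
  have hXc : ∀ w, X.map (mixedSpaceEvalComplex K w) = Lc w := fun w ↦ rfl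
  -- `X` is self-adjoint
  have hX : IsSelfAdjoint X := by
    refine mixedSpace_matrix_ext n K (fun w ↦ ?_) (fun w ↦ ?_)
    · rw [star_map_mixedSpaceEvalReal, hXr, Matrix.star_eq_conjTranspose, (hLr w)]
    · rw [star_map_mixedSpaceEvalComplex, hXc, Matrix.star_eq_conjTranspose, (hLc w)]
  -- `exp X · exp X = g⋆ g`
  have hP : exp X * exp X = star (g : Matrix (Fin n) (Fin n) (mixedSpace K)) * g := by
    refine mixedSpace_matrix_ext n K (fun w ↦ ?_) (fun w ↦ ?_)
    · rw [Matrix.map_mul, Matrix.map_mul, exp_map_mixedSpaceEvalReal, hXr, hLr',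
        star_map_mixedSpaceEvalReal, Matrix.star_eq_conjTranspose]
    · rw [Matrix.map_mul, Matrix.map_mul, exp_map_mixedSpaceEvalComplex, hXc, hLc',
        star_map_mixedSpaceEvalComplex, Matrix.star_eq_conjTranspose]
  -- `k := g · exp (-X)` is unitary and `g = k · exp X`
  refine ⟨g * (expGL X)⁻¹, ?_, X, trivial, hX, by rw [inv_mul_cancel_right]⟩
  rw [RealMatrixGroup.mem_maximalCompact_iff]
  refine ⟨trivial, ?_⟩
  have hneg : exp (-X) * exp X = (1 : Matrix (Fin n) (Fin n) (mixedSpace K)) := by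
    rw [← Matrix.exp_add_of_commute (-X) X ((Commute.refl X).neg_left), neg_add_cancel, exp_zero]
  have hneg' : exp X * exp (-X) = (1 : Matrix (Fin n) (Fin n) (mixedSpace K)) := by
    rw [← Matrix.exp_add_of_commute X (-X) ((Commute.refl X).neg_right), add_neg_cancel, exp_zero]
  rw [← expGL_neg, Units.val_mul, coe_expGL, star_mul, star_exp, star_neg, hX.star_eq]
  calc exp (-X) * star (g : Matrix (Fin n) (Fin n) (mixedSpace K)) *
        ((g : Matrix (Fin n) (Fin n) (mixedSpace K)) * exp (-X))
      = exp (-X) * (star (g : Matrix (Fin n) (Fin n) (mixedSpace K)) * g) * exp (-X) := by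
        simp only [mul_assoc]
    _ = exp (-X) * (exp X * exp X) * exp (-X) := by rw [hP]
    _ = (exp (-X) * exp X) * (exp X * exp (-X)) := by simp only [mul_assoc]
    _ = 1 := by rw [hneg, hneg', mul_one]

/-- The Cartan decomposition of the archimedean group of the `GL_n` automorphy datum
(`(AutomorphyDatum.gl n K hcpt).arch = archGroupGL n K`). Borel–Jacquet 1979, §1.1. [cite: BorelJacquet1979, §1.1] -/
theorem AutomorphyDatum.gl_hasCartanDecomposition (hcpt : isCompact_glFiniteIntegralLevel n K) :
    (AutomorphyDatum.gl n K hcpt).arch.HasCartanDecomposition :=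
  hasCartanDecomposition_archGroupGL n K

end MixedSpace

end Literature.NumberTheory.Automorphic
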